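import Summits.BirchSwinnertonDyer.BirchSwinnertonDyer.Theorems.PrintCf2SplitBadTwoProNullLevelLift
import Summits.BirchSwinnertonDyer.BirchSwinnertonDyer.Theorems.PrintCf2SplitBadTwoLayerShapiroComponents
import HarnessLib

/-!
# Crux `PrintCf2.SplitBadTwoRankOneOfFacts` (stmt-BirchSwinnertonDyer-20368), skeleton v13.1, stub S3n′ `stub_pseudoNullFinite_two`,
# S3N-FACTFREE brick R2, file 4 (B2c of `Cruxes/…/R2-BRICKS-w5g7.md`): THE ASSEMBLY — (SUR_U) AT A FINITE LEVEL: local surjectivity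
# over the layer `K̄^U` for a finite discrete module, modulo unramified classes, in the (LS↑) shape of -w4 g12 with the open subgroup
# `U` for `ker κ₂`, FROM Poitou–Tate over the base `K` and ONE displayed hypothesis: the dual pull-back `H¹(ιc^D)` kills the canonical
# dual Selmer group `H¹_{𝓕*}(K, Maps(Γ_K ⧸ U, M)^D)` — (PRO-NULL) for the two levels `M₀ → M`

Cell `bsd-print-cf2`, WIDTH seat `bsd-line-cf2-p1-w5` g7 (prover-bsd-line-cf2-p1-w5-g7-0); `--supports stmt-BirchSwinnertonDyer-20368`
(helper, Theses-free). HONEST FRAMING: nothing here closes the crux or a registered stub; BSD is not proved by any of this; no summit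
statement is proved by this seat. No definition, no named fact, no `sorry`. CONDITIONAL only on the displayed hypothesis `hkill` (the
arithmetic input (PRO-NULL)_U, memo brick B4 ⟸ R1 = p696581) and on the bookkeeping hypotheses on `S` / `𝓕` (the set of bad places and
the Selmer structure «unramified at `w ∤ p` and at `v̄`», to be instantiated with `M = A_θ[2^m]`, `U = layerSubgroup κ₂ n`).

WHAT. **`exists_layerClass_of_dualPullback_eq_zero`**: `K` a number field, `U ⊴ Γ_K` open of finite index, `M₀ →j M` finite discrete
`Γ_K`-modules (`n • M = 0`) with the coinduced intertwining map `ιc` (`hιc`), a finite set of places `S` off which `n` is invertible and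
`Maps(Γ_K ⧸ U, M)` unramified (`hS`), a Selmer structure `𝓕` on `Maps(Γ_K ⧸ U, M)` unramified outside `S` (`h𝓕S`) which IS the unramified
condition at every `w ∤ p` and at `w = v̄` (`h𝓕u`), a finite set `T ⊆ S` of such places and layer-local targets
`τ₀ w q ∈ H¹(U ⊓ D_w, M₀)` at the places `q ∈ D_w \ Γ_K / U` of `K̄^U` above `w ∈ T`. IF `H¹(ιc^D)` kills `H¹_{𝓕*}(K, Maps(Γ_K ⧸ U, M)^D)`
(canonical local invariant maps) THEN there is `z ∈ H¹(U, M)` with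
 (1) `∀ w ∈ T, ∀ q, resOfLe (inertiaIn ≤ decompIn) (resH1Hom (decompInToH U w) id (conjH1 U M q.out z) − j_* (τ₀ w q)) = 0`, and
 (2) `∀ w ∉ T` with `w ∤ p ∨ w = v̄`, `∀ σ, conjH1 U M σ z ∈ unramifiedKer U M w`
— literally the two clauses of (LS↑) (`UpperBaseLift.baseLift_unr₂_of_locSurj`, hypothesis `hLS`) with `U` for `κ₂.kerSubgroup` and the
targets pushed from the lower level. PROOF = composition of the three previous files: test family `H¹(ιc_w) t₀(w)` on `T` from the component
reading (p702356 `exists_localClass_reading`), `𝓖 := 𝓕` relaxed on `T`, Poitou–Tate surgery (p700098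
`ProNullLift.exists_selmer_sub_localMap_mem_canonical_of_dualPullback_eq_zero`), `x = Sh z` (`shapiroLift_surjective`), clause (1) by the component
reading, clause (2) by the unramified reading (p701285 `conjH1_mem_unramifiedKer_of_localization_shapiroLift_mem`).
**`exists_layerClass_of_dualSelmer_eq_bot`** — one level (`M₀ = M`): if the canonical dual Selmer group `H¹_{𝓕*}(K, Maps(Γ_K ⧸ U, M)^D)` is ZERO
then (SUR_U) holds for `M` on the nose of the (LS↑) shape (Greenberg–Vatsal's criterion at a finite layer).
NOT here (memo B2d/B3/B4): the `U`-currency unfolding of `hkill` (Kummer), the passage to the divisible `A_θ`, the limit over the layers.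
presearch: GV 2000 Prop. 2.1; Greenberg 2010 Prop. 3.2.1 (tree `SurLambda.exists_phi_eq_of_level`, base field only); no new fact.
beyond-print theorem: no.

References: [GreenbergVatsal2000] §2 Prop. 2.1; [Greenberg2010] Prop. 3.2.1; [MilneADT2006] I Thm. 4.10 (b); [Howard2004HeegnerKolyvagin]
Thm. 2.1.11; [NeukirchSchmidtWingberg2008] I §6 (1.6.4)–(1.6.5); [Brown1982] III §5 (5.6)(b).
-/

noncomputable section

open scoped Classical ContRepresentation

set_option linter.dupNamespace false
set_option autoImplicit false

open CategoryTheory NumberField IsDedekindDomain Field ValuativeRel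
open Literature.NumberTheory.EllipticCurves Literature.NumberTheory.EllipticCurves.GreenbergSelmer
open Literature.NumberTheory.EllipticCurves.GreenbergVatsal2000
open Literature.NumberTheory.GaloisRepresentations
open Literature.NumberTheory.GaloisRepresentations.DiscreteGaloisModule (SelmerStructure)
open Literature.NumberTheory.GaloisCohomology
open Summit.BirchSwinnertonDyer.Rank1Residual.X11b.LocBridge
open Summit.BirchSwinnertonDyer.Rank1Residual.GaloisImage.Transport (tateDualComap)
open Summit.BirchSwinnertonDyer.BirchSwinnertonDyer.Theorems.PrintCf2.LayerShapiro
open Summit.BirchSwinnertonDyer.BirchSwinnertonDyer.Theorems.PrintCf2.ProNullLift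

namespace Summit.BirchSwinnertonDyer.BirchSwinnertonDyer.Theorems.PrintCf2.LayerShapiro

variable {K : Type} [Field K] [NumberField K]
variable {M₀ M : Type} [AddCommGroup M₀] [DistribMulAction (absoluteGaloisGroup K) M₀] [TopologicalSpace M₀] [DiscreteTopology M₀]
  [AddCommGroup M] [DistribMulAction (absoluteGaloisGroup K) M] [TopologicalSpace M] [DiscreteTopology M] [Finite M₀] [Finite M]
  (hM₀ : ∀ m : M₀, IsOpen {σ : absoluteGaloisGroup K | σ • m = m})
  (hM : ∀ m : M, IsOpen {σ : absoluteGaloisGroup K | σ • m = m})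
  (U : Subgroup (absoluteGaloisGroup K)) [U.Normal] (hU : IsOpen (U : Set (absoluteGaloisGroup K)))
  [Fintype (absoluteGaloisGroup K ⧸ U)]

/-- **(SUR_U) AT A FINITE LEVEL FROM A VANISHING DUAL PULL-BACK.** See the module docstring. The only arithmetic input is `hkill`:
`H¹(ιc^D) y = 0` for every `y` in the canonical dual Selmer group of `𝓕` — for the two levels `A[p^k] ↪ A[p^m]` this is (PRO-NULL).
[cite: GreenbergVatsal2000, §2 Prop. 2.1] [cite: MilneADT2006, Ch. I, Thm. 4.10 (b)] [cite: Howard2004HeegnerKolyvagin, Thm. 2.1.11 (arXiv:1202.6340 p. 6)]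
[cite: NeukirchSchmidtWingberg2008, I §6 Prop. (1.6.4)–(1.6.5)] -/
theorem exists_layerClass_of_dualPullback_eq_zero (p : ℕ) (n : ℕ) [NeZero n] (hMn : ∀ m : M, n • m = 0)
    (ιc : ((ofSMul M₀ hM₀).coind U hU).toContRepresentation →ⁱL ((ofSMul M hM).coind U hU).toContRepresentation)
    (j : M₀ →+ M) (hj : ∀ (σ : absoluteGaloisGroup K) (m : M₀), j (σ • m) = σ • j m)
    (hιc : ∀ (φ : absoluteGaloisGroup K ⧸ U → M₀) (y : absoluteGaloisGroup K ⧸ U), ιc φ y = j (φ y))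
    (vbar : HeightOneSpectrum (𝓞 K)) (S : Finset (Place K))
    (hS : ∀ w : HeightOneSpectrum (𝓞 K), (Sum.inr w : Place K) ∉ S →
      ((n : ℕ) : 𝓞 K) ∉ w.asIdeal ∧ GaloisRep.IsUnramifiedAt w ((ofSMul M hM).coind U hU))
    (𝓕 : SelmerStructure ((ofSMul M hM).coind U hU)) (h𝓕S : 𝓕.IsUnramifiedOutside S)
    (h𝓕u : ∀ w : HeightOneSpectrum (𝓞 K), (((p : ℕ) : 𝓞 K) ∉ w.asIdeal ∨ w = vbar) →
      𝓕 (Sum.inr w) = DiscreteGaloisModule.unramifiedSubgroup (GaloisRep.toLocal w ((ofSMul M hM).coind U hU)) 1)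
    (T : Finset (HeightOneSpectrum (𝓞 K))) (hT : ∀ w ∈ T, ((p : ℕ) : 𝓞 K) ∉ w.asIdeal ∨ w = vbar)
    (hTS : ∀ w ∈ T, (Sum.inr w : Place K) ∈ S)
    (τ₀ : (w : HeightOneSpectrum (𝓞 K)) →
      DoubleCoset.Quotient (decomp (K := K) w : Set (absoluteGaloisGroup K)) (U : Set (absoluteGaloisGroup K)) →
        subgroupH1 (decompIn U w) M₀)
    (hkill : ∀ y ∈ ((LocalInvariants.canonical K n).dualSelmerStructure ((ofSMul M hM).coind U hU) 𝓕).selmerGroup,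
      galoisCohomology.map (tateDualComap ιc) 1 y = 0) :
    ∃ z : subgroupH1 U M,
      (∀ w ∈ T, ∀ q : DoubleCoset.Quotient (decomp (K := K) w : Set (absoluteGaloisGroup K)) (U : Set (absoluteGaloisGroup K)),
        resOfLe M (inertiaIn_le_decompIn U w)
          (resH1Hom (decompInToH U w) (AddMonoidHom.id M) (fun _ _ ↦ rfl) (conjH1 U M q.out z) -
            resH1Hom (ContinuousMonoidHom.id (decompIn U w)) j (fun _ m ↦ hj _ m) (τ₀ w q)) = 0) ∧
      (∀ w : HeightOneSpectrum (𝓞 K), w ∉ T → (((p : ℕ) : 𝓞 K) ∉ w.asIdeal ∨ w = vbar) →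
        ∀ σ : absoluteGaloisGroup K, conjH1 U M σ z ∈ GreenbergVatsal2000.unramifiedKer U M w) := by
  -- representatives of `Γ_K ⧸ U` for the Shapiro lift
  obtain ⟨s, hs, hs1⟩ := exists_reps_one (N := U)
  -- local classes with the prescribed components, one per `w`
  choose t₀ ht₀ using fun w ↦ exists_localClass_reading hM₀ hM U hU hs hs1 w ιc j hj hιc (τ₀ w)
  -- the relaxed structure `𝓖 = 𝓕` with `⊤` on `T`
  let 𝓖 : SelmerStructure ((ofSMul M hM).coind U hU) := fun v ↦ if v ∈ T.image Sum.inr then ⊤ else 𝓕 v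
  have hle : 𝓕 ≤ 𝓖 := fun v ↦ by
    by_cases hv : v ∈ T.image Sum.inr
    · simp only [𝓖, if_pos hv]; exact le_top
    · simp only [𝓖, if_neg hv]; exact le_rfl
  have h𝓖S : 𝓖.IsUnramifiedOutside S := by
    refine ⟨h𝓕S.1, fun v hv ↦ ?_⟩
    have hvT : (Sum.inr v : Place K) ∉ T.image Sum.inr := fun h ↦ by
      obtain ⟨w, hw, hwv⟩ := Finset.mem_image.1 h
      exact hv (Sum.inr_injective hwv ▸ hTS w hw)
    simp only [𝓖, if_neg hvT]
    exact h𝓕S.2 v hv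
  -- the test family: the local classes on `T`, zero elsewhere
  let sfam : Π v : Place K, galoisCohomology (((ofSMul M₀ hM₀).coind U hU).toLocal v) 1 := fun v ↦
    match v with
    | Sum.inl _ => 0
    | Sum.inr w => if w ∈ T then t₀ w else 0
  have hsfam : ∀ v ∈ S, DiscreteGaloisModule.localMap ιc v (sfam v) ∈ 𝓖 v := by
    intro v _
    rcases v with w | w
    · change DiscreteGaloisModule.localMap ιc _ 0 ∈ _; rw [map_zero]; exact zero_mem _
    · by_cases hw : w ∈ T
      · have hv : (Sum.inr w : Place K) ∈ T.image Sum.inr := Finset.mem_image_of_mem _ hw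
        simp only [𝓖, if_pos hv]; exact AddSubgroup.mem_top _
      · change DiscreteGaloisModule.localMap ιc _ (if w ∈ T then t₀ w else 0) ∈ _
        rw [if_neg hw, map_zero]; exact zero_mem _
  -- Poitou–Tate over `K` for the coinduced modules
  have hMc : ∀ φ : absoluteGaloisGroup K ⧸ U → M, n • φ = 0 := fun φ ↦ funext fun y ↦ by
    rw [Pi.smul_apply, Pi.zero_apply]; exact hMn (φ y)
  obtain ⟨x, hx𝓖, hxS⟩ := exists_selmer_sub_localMap_mem_canonical_of_dualPullback_eq_zero
    ((ofSMul M₀ hM₀).coind U hU) ((ofSMul M hM).coind U hU) n ιc hMc S hS hle h𝓕S h𝓖S sfam hsfam hkill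
  -- `x` is a Shapiro lift
  obtain ⟨z, rfl⟩ := shapiroLift_surjective (ofSMul M hM).toTopRep U hU hs hs1 x
  refine ⟨z, fun w hw q ↦ ?_, fun w hwT hw σ ↦ ?_⟩
  · -- clause 1: the matching on `T`
    have h := hxS (Sum.inr w) (hTS w hw)
    change galoisCohomology.localization ((ofSMul M hM).coind U hU) (Sum.inr w) 1 _ -
      DiscreteGaloisModule.localMap ιc (Sum.inr w) (if w ∈ T then t₀ w else 0) ∈ 𝓕 (Sum.inr w) at h
    rw [if_pos hw, h𝓕u w (hT w hw)] at h
    exact ht₀ w z h q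
  · -- clause 2: unramified off `T`
    have h := (SelmerStructure.mem_selmerGroup_iff 𝓖 _).1 hx𝓖 (Sum.inr w)
    have hv : (Sum.inr w : Place K) ∉ T.image Sum.inr := fun h' ↦ by
      obtain ⟨w', hw', hww⟩ := Finset.mem_image.1 h'
      exact hwT (Sum.inr_injective hww ▸ hw')
    simp only [𝓖, if_neg hv] at h
    rw [h𝓕u w hw] at h
    exact conjH1_mem_unramifiedKer_of_localization_shapiroLift_mem hM U hU hs hs1 w z h σ

/-- **(SUR_U) AT A FINITE LEVEL FROM THE VANISHING OF THE DUAL SELMER GROUP** (one level, `M₀ = M`): if the canonical dual Selmer group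
`H¹_{𝓕*}(K, Maps(Γ_K ⧸ U, M)^D)` is zero, every family of layer-local targets above `T` is realised, modulo classes dying on `U ⊓ I_w`, by a
layer class unramified above every other `w ∤ p` / `w = v̄` — the two clauses of (LS↑) with `U` for `ker κ₂`.
[cite: GreenbergVatsal2000, §2 Prop. 2.1] [cite: MilneADT2006, Ch. I, Thm. 4.10 (b)] -/
theorem exists_layerClass_of_dualSelmer_eq_bot (p : ℕ) (n : ℕ) [NeZero n] (hMn : ∀ m : M, n • m = 0)
    (vbar : HeightOneSpectrum (𝓞 K)) (S : Finset (Place K))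
    (hS : ∀ w : HeightOneSpectrum (𝓞 K), (Sum.inr w : Place K) ∉ S →
      ((n : ℕ) : 𝓞 K) ∉ w.asIdeal ∧ GaloisRep.IsUnramifiedAt w ((ofSMul M hM).coind U hU))
    (𝓕 : SelmerStructure ((ofSMul M hM).coind U hU)) (h𝓕S : 𝓕.IsUnramifiedOutside S)
    (h𝓕u : ∀ w : HeightOneSpectrum (𝓞 K), (((p : ℕ) : 𝓞 K) ∉ w.asIdeal ∨ w = vbar) →
      𝓕 (Sum.inr w) = DiscreteGaloisModule.unramifiedSubgroup (GaloisRep.toLocal w ((ofSMul M hM).coind U hU)) 1)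
    (T : Finset (HeightOneSpectrum (𝓞 K))) (hT : ∀ w ∈ T, ((p : ℕ) : 𝓞 K) ∉ w.asIdeal ∨ w = vbar)
    (hTS : ∀ w ∈ T, (Sum.inr w : Place K) ∈ S)
    (τ : (w : HeightOneSpectrum (𝓞 K)) →
      DoubleCoset.Quotient (decomp (K := K) w : Set (absoluteGaloisGroup K)) (U : Set (absoluteGaloisGroup K)) →
        subgroupH1 (decompIn U w) M)
    (hbot : ∀ y ∈ ((LocalInvariants.canonical K n).dualSelmerStructure ((ofSMul M hM).coind U hU) 𝓕).selmerGroup, y = 0) :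
    ∃ z : subgroupH1 U M,
      (∀ w ∈ T, ∀ q : DoubleCoset.Quotient (decomp (K := K) w : Set (absoluteGaloisGroup K)) (U : Set (absoluteGaloisGroup K)),
        resOfLe M (inertiaIn_le_decompIn U w)
          (resH1Hom (decompInToH U w) (AddMonoidHom.id M) (fun _ _ ↦ rfl) (conjH1 U M q.out z) - τ w q) = 0) ∧
      (∀ w : HeightOneSpectrum (𝓞 K), w ∉ T → (((p : ℕ) : 𝓞 K) ∉ w.asIdeal ∨ w = vbar) →
        ∀ σ : absoluteGaloisGroup K, conjH1 U M σ z ∈ GreenbergVatsal2000.unramifiedKer U M w) := by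
  obtain ⟨z, h1, h2⟩ := exists_layerClass_of_dualPullback_eq_zero hM hM U hU p n hMn ContIntertwiningMap.id
    (AddMonoidHom.id M) (fun _ _ ↦ rfl) (fun _ _ ↦ rfl) vbar S hS 𝓕 h𝓕S h𝓕u T hT hTS τ
    (fun y hy ↦ by rw [hbot y hy, map_zero])
  refine ⟨z, fun w hw q ↦ ?_, h2⟩
  have h := h1 w hw q
  rwa [resH1Hom_id] at h

end Summit.BirchSwinnertonDyer.BirchSwinnertonDyer.Theorems.PrintCf2.LayerShapiro

end
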